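import Literature.AlgebraicGeometry.Frobenioids.ArchimedeanBoundaryOpensAngular
import Literature.AlgebraicGeometry.Frobenioids.ArchimedeanBoundaryTorsor
import HarnessLib

/-!
# Frobenioids II, Theorem 3.6 (vii) — PROVED IN FULL for `C = C^ℤ` and for the angular Frobenioid `A`

Mochizuki, *The geometry of Frobenioids II*, Kyushu J. Math. **62** (2008) 401–460, §3, Theorem 3.6 (vii),
author's kurims text pp. 37–38 [cite: MochizukiFrdII2008, Thm 3.6 (vii) p.37]:

> "(vii) Suppose that `Λ = ℤ`. Let `A ∈ Ob(F)` be complex. Then the assignment that maps an isometric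
> pre-step `B → A` of `F` to the image of the boundary `∂A_B` of the angular region `A_B` of `B` in the
> boundary `∂A_A` of the angular region `A_A` of `A` determines an equivalence of categories — which is
> functorial […] in `A` — `F^imtr-pre_A ⥲ Open⁰(∂A_A)` […]. In particular, [cf. Theorem A.2, (vi)] the
> topological space `∂A_A` may be recovered functorially from the category `F^imtr-pre_A`. Finally, if `A`
> is isotropic, then the action of `O^×(A)` on `∂A_A` determines on `∂A_A` a structure of torsor over this
> group."

This file assembles the DISCHARGE of the instances `ArchFrd.Thm36vii_C π` and `ArchFrd.Thm36vii_A π` of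
`ArchimedeanTheoremsInstances.lean` (the printed claim at the categories of Example 3.3 over ANY base
`π : D → D₀`) from the three clauses proved separately by seat abc-iut-L1-t9: the equivalence
(`ArchimedeanBoundaryOpensEquiv.lean` / `ArchimedeanBoundaryOpensAngular.lean`), the recovery hypotheses
of Thm. A.2 (vi) — `∂A_A` sober and locally connected (`ArchimedeanBoundaryRecover.lean`), and the torsor
clause (`ArchimedeanBoundaryTorsor.lean`). (The clause "functorial in `A` [cf. [FrdI] Prop. 1.9 (ii),
(iii)]" refers to abc-iut-L1-t1's functors `φ_*`, `φ^*` and is not typed separately, as recorded in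
`ArchimedeanBasicProperties.lean`.) No statement of the paper is strengthened; typed = proved here;
nothing in this file bears on [IUTchIII] Cor. 3.12.
-/

namespace Literature.AlgebraicGeometry.Frobenioids

open CategoryTheory

universe v u

namespace ArchFrd

variable {D : Type u} [Category.{v} D] (π : D ⥤ D0)

/-- **Theorem 3.6 (vii) for `C = C^ℤ`** (PROVED): equivalence `C^imtr-pre_A ⥲ Open⁰(∂A_A)`, recovery of
`∂A_A`, and the `O^×(A)`-torsor structure, for every complex `A ∈ Ob(C)` over any base `π : D → D₀`.
[cite: MochizukiFrdII2008, Thm 3.6 (vii) p.37] -/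
theorem thm36vii_C : Thm36vii_C π :=
  ⟨thm36vii_equiv_C π, thm36vii_recover_C π, thm36vii_torsor_C π⟩

/-- **Theorem 3.6 (vii) for the angular Frobenioid `A`** (PROVED): the same three clauses for `F = A`.
[cite: MochizukiFrdII2008, Thm 3.6 (vii) p.37] -/
theorem thm36vii_A : Thm36vii_A π :=
  ⟨thm36vii_equiv_A π, thm36vii_recover_A π, thm36vii_torsor_A π⟩

end ArchFrd

end Literature.AlgebraicGeometry.Frobenioids
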